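/-
Copyright (c) 2026 the pub-hodgecm-mathlib formalisation cell (harness21).  Prover seat hodgecm-mathlib-K2E1-p16 (g4), Track B ∕ K2-LIT, h413 = `stmt-HodgeConjecture-24833`,
R90-TF section S8 «ContSpec-n½», socket (E) :276 (N₃) row per `K_∞`-type, S8 dealer R90-CS-plan (g4) S8-R254 (8)+(9) ∕ S8-R256 (5) (E1-PLANCHEREL BODY cut into bricks; joint
census `R90/S8/CENSUS-PlancherelBody-bricks.K2E1-p16-F0P2-p10.md`, bricks PB-3 + PB-4): THE LINE MODEL `U`, ITS HECKE LETTER `hU` AND ITS KERNEL LETTER `hLnU` FROM A GRAM IDENTITY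
WITH PROJECTED RESIDUAL PART — abstract Hilbert-space file (no automorphic object).  Mathlib + ★ `K2E1PlancherelIsometryOfForm` + ★ `K2E1PlancherelModelMapOfIsometry` + ★ D4′b-2.
-/
import Summits.HodgeConjecture.HodgeConjecture.Theorems.K2E1SymbolActionThroughModelMap   -- ★ (K2E4-p23) D4′b-2: `map_mem_orthogonal_of_adjoint`; brings ★ `K2E1PlancherelIsometryOfForm` (`exists_linearIsometry_of_inner_eq_add`, `linearIsometry_apply_linearCombination`, `denseRange_codRestrict_linearCombination`), ★ `K2E1PlancherelModelMapOfIsometry`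
import Mathlib.MeasureTheory.Function.Holder
import Mathlib.MeasureTheory.Function.L2Space
import Mathlib.Analysis.InnerProductSpace.Adjoint
import HarnessLib

/-!
# R90-TF · S8 «ContSpec-n½» — `R90S8PlancherelLineModelOfGram`: THE LINE MODEL OF A GRAM IDENTITY WITH PROJECTED RESIDUAL PART (bricks PB-3 + PB-4 of the E1-Plancherel body)

Cell `hodgecm-mathlib`, crux H413 (`stmt-HodgeConjecture-24833`, lane `--supports … --as helper`), route of record `HCCMUnconditional`; R90-TF section S8, socket (E) `sock_S8_res_exhaustion_le_closure`
(B ED. 7 :276), (N₃) row per `K_∞`-type through ★ `hNblk_of_tauCuts` ∘ ★ `resG_isotypic_le_orthogonal_of_lineModel_of_conv`, whose bill carries the LINE-MODEL LETTERS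
(L2) `U : L² →ₗ[ℂ] Lp E 2 m`, `hU : ∀ j, ∀ v ∈ Fix P, U (T j v) = (hs j).toLp (s j) • U v` and (C) `hLnU : ∀ v ∈ Ln, ∀ y ∈ Fix P, U y = 0 → ⟪v, y⟫ = 0` (`Ln = Sc_τ ⊓ Aᗮ`).  THIS FILE pays
all three from ONE Gram identity and generator-level Hecke equivariance — abstract Hilbert space, THEOREMS ONLY (no `def`, no `instance`, no `notation`, no named-fact hypothesis, no `sorry`;
default heartbeats); count-neutral; CLOSES NO SOCKET.

THE MATHEMATICS ([MoeglinWaldspurger1995] II.2.4, IV.3.1, VI.2; [ReedSimonI1980] Thm. I.7, II.3; [Langlands1976] §7).  `H` a Hilbert space (E1: `L²([G])`), `x : ι → H` the pseudo-Eisenstein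
vectors `θ_{f,φ}` of one τ-cut block, `Θ := closure span {x i}` (= `Sc_τ` by the τ-cut density PB-0′), `R ≤ H` a subspace with orthogonal projection `P_R` (E1: the span of the finitely many
residues `Res_{z_k} E(z, φ)` at level, finite-dimensional), `c : ι → M₂` the continuous coordinates (E1: `M₂ = L²(ℝ; E)`, `c i = (y ↦ f̂_i(1+iy)·φ_i)` suitably normalised).  THE GRAM IDENTITY WITH
PROJECTED RESIDUAL PART (PB-2's output, the contour shift `Re z = c₀ → 1`): **`hG : ⟪x i, x j⟫ = ⟪P_R (x i), P_R (x j)⟫ + ⟪c i, c j⟫`**.  By ★ `exists_linearIsometry_of_inner_eq_add` there is an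
isometry `Uiso : Θ →ₗᵢ H ⊕₂ M₂` with `Uiso (x i) = (P_R (x i), c i)`; §2 shows ITS FIRST COORDINATE IS `P_R` (density: both are continuous and agree on generators), hence by Pythagoras
`‖(Uiso v).2‖ = ‖v − P_R v‖` and **`(Uiso v).2 = 0 ↔ v ∈ R`** — the residue identification of PB-4 is FREE in this design (no residue-model letter).  §3: a bounded `T` with `T (x i) = x (σ i)`
(PB-3a: unramified Hecke operators permute flat sections, `T_v θ_{f,φ} = θ_{λ_v⋆f,φ}`) and a bounded `S₂` on `M₂` with `c (σ i) = S₂ (c i)` (the symbol: `(λ_v⋆f)^ = λ_v·f̂`) satisfy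
`(Uiso (T v)).2 = S₂ (Uiso v).2` on `Θ` (density again), and if also `T† (x i) ∈ Θ` then `P_Θ ∘ T = T ∘ P_Θ` on `H` (★ `map_mem_orthogonal_of_adjoint`), so the GLOBAL MODEL MAP
`U := snd ∘ Uiso ∘ P_Θ : H →ₗ M₂` obeys `U (T v) = S₂ (U v)` for EVERY `v ∈ H`.  §4 packages: `∃ U`, `U (x i) = c i`, `hU` (for a family `T j`, symbols `S₂ j`), `U = 0` on `Θᗮ`,
`‖U v‖ = ‖v − P_R v‖` on `Θ`, `U y = 0 → P_Θ y ∈ R`, and the (C)-shape `v ∈ Θ, v ⟂ R, U y = 0 ⟹ ⟪v, y⟫ = 0`; §5 is the Hölder edition `S₂ j = ((hs j).toLp (s j) • ·)` in the consumer's bytes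
with `Θ = Sc′`, `R ≤ A`: `hU` VERBATIM (even without the `Fix P` guard) and `hLnU` VERBATIM at `Ln := Sc′ ⊓ Aᗮ`.
* §1 `map_mem_topologicalClosure_span_of_apply_mem` — generator-level stability ⇒ stability of the closed span.
* §2 `fst_isometry_eq_starProjection`, `norm_snd_isometry_eq`, **`snd_isometry_eq_zero_iff`**.
* §3 `snd_isometry_map_eq_of_equivariant` (on `Θ`), `coe_orthogonalProjectionOnto_map_eq` (`P_Θ (T v) = T (P_Θ v)`).
* §4 **`exists_lineModel_of_gram_proj`** (generic symbols `S₂ j`).  §5 **`exists_lineModelLetters_of_gram_proj`** (Hölder symbols; the (L2) + (C) letters of the τ-cut bill).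
* §6 `inner_starProjection_eq_of_residueGram` (abstract residual models `r i ∈ M₁` + residue vectors `e p ∈ H` with models `b p` ⇒ `⟪P_R x i, P_R x j⟫ = ⟪r i, r j⟫`, `R = closure span e`),
  **`exists_lineModelLetters_of_gram_residueGram`** (the same letters from the ABSTRACT Gram identity `⟪x i, x j⟫ = ⟪r i, r j⟫ + ⟪c i, c j⟫` — PB-2c's currency — plus the residue Gram letters).
HONEST LABEL: HC_CM is proved only modulo the 7 printed citations (2 remaining named inputs: hLiu418 = `stmt-HodgeConjecture-24832`, h413 = `stmt-HodgeConjecture-24833`) until rung 0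
closes; this file is sorry-free and unconditional but HYPOTHESIS-FIRST on PB-2 (`hG`, the Gram identity by contour shift, with the residues in `R ≤ A`) and PB-3a (`hTx`, `hTadjx`, `hSymb`,
unramified Hecke action on flat sections and its symbol) — neither is claimed here; REL ≠ ★ ≠ BUILT; asserts no named fact, closes no socket; count-neutral.

## References
* [MoeglinWaldspurger1995] C. Mœglin, J.-L. Waldspurger, *Spectral decomposition and Eisenstein series* (1995), II.2.4, IV.3.1, VI.2 (the spectral isometry; residual + continuous parts).
* [Langlands1976] R. P. Langlands, *On the functional equations satisfied by Eisenstein series*, LNM 544 (1976), §7 (contour shift; the `L²` decomposition).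
* [ReedSimonI1980] M. Reed, B. Simon, *Methods of Modern Mathematical Physics I* (1980), Thm. I.7 (BLT extension), Thm. II.3 (projection theorem).
-/

set_option autoImplicit false
set_option linter.dupNamespace false  -- the mandated namespace `…HodgeConjecture.HodgeConjecture.R90.S8` (LEAD #1 L1) repeats the summit's segment

noncomputable section

open MeasureTheory Set Submodule Filter Topology
open scoped InnerProductSpace ENNReal
open Summit.HodgeConjecture.HodgeConjecture.Cruxes.H413.K2E1PlancherelIsometryOfForm
open Summit.HodgeConjecture.HodgeConjecture.Cruxes.H413.K2E1PlancherelModelMapOfIsometry (completeSpace_topologicalClosure_span)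
open Summit.HodgeConjecture.HodgeConjecture.Cruxes.H413.K2E1SymbolActionThroughModelMap (map_mem_orthogonal_of_adjoint)

namespace Summit.HodgeConjecture.HodgeConjecture.R90.S8

variable {ι H M₂ : Type*} [NormedAddCommGroup H] [InnerProductSpace ℂ H] [NormedAddCommGroup M₂] [InnerProductSpace ℂ M₂]

/-! ## §1 Generator-level stability passes to the closed span -/

/-- **GENERATORS SUFFICE FOR STABILITY**: if a bounded operator `A` maps every generator `x i` into `Θ = closure span {x i}`, then `A Θ ⊆ Θ` (`Θ ≤ A⁻¹Θ`, a closed submodule containing the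
generators).  E1: `T_v θ_{f,φ} = θ_{λ_v⋆f,φ}` (PB-3a) makes the τ-cut block `T_v`-stable, and the same for `T_v† = T_{v}^{*}`. [cite: ReedSimonI1980, Thm. I.7] -/
theorem map_mem_topologicalClosure_span_of_apply_mem (x : ι → H) (A : H →L[ℂ] H) (hA : ∀ i, A (x i) ∈ (span ℂ (Set.range x)).topologicalClosure)
    {v : H} (hv : v ∈ (span ℂ (Set.range x)).topologicalClosure) : A v ∈ (span ℂ (Set.range x)).topologicalClosure := by
  have hle : span ℂ (Set.range x) ≤ ((span ℂ (Set.range x)).topologicalClosure).comap A.toLinearMap :=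
    span_le.2 (Set.range_subset_iff.2 fun i => hA i)
  exact (span ℂ (Set.range x)).topologicalClosure_minimal hle (((span ℂ (Set.range x)).isClosed_topologicalClosure).preimage A.continuous) hv

/-! ## §2 The residual coordinate of the isometry is `P_R`; the continuous coordinate measures the distance to `R` -/

section Isometry

variable (R : Submodule ℂ H) [R.HasOrthogonalProjection] {x : ι → H} {c : ι → M₂}
  (Uiso : (span ℂ (Set.range x)).topologicalClosure →ₗᵢ[ℂ] WithLp 2 (H × M₂))
  (hUiso : ∀ i, Uiso ⟨x i, mem_topologicalClosure_span x i⟩ = WithLp.toLp 2 (R.starProjection (x i), c i))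

include hUiso

/-- **THE FIRST COORDINATE OF THE ISOMETRY IS THE PROJECTION ONTO `R`**: for an isometry `Uiso : Θ →ₗᵢ H ⊕₂ M₂` with `Uiso (x i) = (P_R (x i), c i)`, `(Uiso v).1 = P_R v` for every `v ∈ Θ`
(both sides are continuous in `v` and agree on the dense finite combinations).  E1: the residual part of a vector of the block is its projection onto the span of the residues.
[cite: MoeglinWaldspurger1995, II.2.4, VI.2] [cite: ReedSimonI1980, Thm. I.7] -/
theorem fst_isometry_eq_starProjection (v : (span ℂ (Set.range x)).topologicalClosure) : (WithLp.ofLp (Uiso v)).1 = R.starProjection (v : H) := by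
  refine (denseRange_codRestrict_linearCombination x).induction_on v
    (isClosed_eq (continuous_fst.comp ((WithLp.prod_continuous_ofLp 2 H M₂).comp Uiso.continuous)) (R.starProjection.continuous.comp continuous_subtype_val)) fun l => ?_
  change (WithLp.ofLp (Uiso ⟨Finsupp.linearCombination ℂ x l, linearCombination_mem_topologicalClosure x l⟩)).1 = R.starProjection (Finsupp.linearCombination ℂ x l)
  rw [linearIsometry_apply_linearCombination Uiso hUiso l]
  have h1 := Finsupp.apply_linearCombination ℂ ((LinearMap.fst ℂ H M₂).comp (WithLp.linearEquiv 2 ℂ (H × M₂)).toLinearMap)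
    (fun i => WithLp.toLp 2 (R.starProjection (x i), c i)) l
  have h2 := Finsupp.apply_linearCombination ℂ R.starProjection.toLinearMap x l
  rw [LinearMap.comp_apply, LinearMap.fst_apply] at h1
  rw [ContinuousLinearMap.coe_coe] at h2
  rw [h2]
  exact h1

/-- **THE CONTINUOUS COORDINATE MEASURES THE DISTANCE TO `R`**: `‖(Uiso v).2‖ = ‖v − P_R v‖` for `v ∈ Θ` (isometry + §2 first coordinate + Pythagoras `‖v‖² = ‖P_R v‖² + ‖v − P_R v‖²`).
[cite: MoeglinWaldspurger1995, II.2.4, VI.2] [cite: ReedSimonI1980, Thm. II.3] -/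
theorem norm_snd_isometry_eq (v : (span ℂ (Set.range x)).topologicalClosure) : ‖(WithLp.ofLp (Uiso v)).2‖ = ‖(v : H) - R.starProjection (v : H)‖ := by
  have h1 : ‖Uiso v‖ ^ 2 = ‖(WithLp.ofLp (Uiso v)).1‖ ^ 2 + ‖(WithLp.ofLp (Uiso v)).2‖ ^ 2 := WithLp.prod_norm_sq_eq_of_L2 (Uiso v)
  rw [Uiso.norm_map, fst_isometry_eq_starProjection R Uiso hUiso v] at h1
  have h2 : ‖(v : H)‖ ^ 2 = ‖R.starProjection (v : H)‖ ^ 2 + ‖Rᗮ.starProjection (v : H)‖ ^ 2 := R.norm_sq_eq_add_norm_sq_starProjection (v : H)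
  rw [starProjection_orthogonal_val] at h2
  have h3 : ‖v‖ = ‖(v : H)‖ := rfl
  rw [h3] at h1
  exact (sq_eq_sq₀ (norm_nonneg _) (norm_nonneg _)).1 (by linarith)

/-- **RESIDUE IDENTIFICATION, LETTER-FREE**: `(Uiso v).2 = 0 ↔ v ∈ R` for `v ∈ Θ` — a vector of the block has vanishing continuous coordinate iff it lies in the residue space.  E1 (PB-4):
the kernel of the Plancherel coordinate on the τ-cut block is exactly the span of the residues. [cite: MoeglinWaldspurger1995, II.2.4, IV.3.1, VI.2] -/
theorem snd_isometry_eq_zero_iff (v : (span ℂ (Set.range x)).topologicalClosure) : (WithLp.ofLp (Uiso v)).2 = 0 ↔ (v : H) ∈ R := by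
  rw [← norm_eq_zero, norm_snd_isometry_eq R Uiso hUiso v, norm_eq_zero, sub_eq_zero, eq_comm, starProjection_eq_self_iff]

/-! ## §3 The continuous coordinate intertwines `T` with its symbol -/

/-- **EQUIVARIANCE ON `Θ`**: if `T (x i) = x (σ i)` (so `T Θ ⊆ Θ`, §1) and `c (σ i) = S₂ (c i)`, then `(Uiso (T v)).2 = S₂ (Uiso v).2` for every `v ∈ Θ` (both sides continuous in `v`, equal on
finite combinations: `T (Σ lᵢxᵢ) = Σ lᵢ x_{σ i}`, `Σ lᵢ c_{σ i} = S₂ (Σ lᵢcᵢ)`).  E1 (PB-3): `T_v θ_{f,φ} = θ_{λ_v⋆f,φ}`, `(λ_v⋆f)^ = λ_v·f̂`. [cite: MoeglinWaldspurger1995, II.2.4, VI.2] -/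
theorem snd_isometry_map_eq_of_equivariant (T : H →L[ℂ] H) (σ : ι → ι) (hTx : ∀ i, T (x i) = x (σ i)) (S₂ : M₂ →L[ℂ] M₂) (hSymb : ∀ i, c (σ i) = S₂ (c i))
    (v : (span ℂ (Set.range x)).topologicalClosure) :
    (WithLp.ofLp (Uiso ⟨T v, map_mem_topologicalClosure_span_of_apply_mem x T (fun i => (hTx i) ▸ mem_topologicalClosure_span x (σ i)) v.2⟩)).2 =
      S₂ (WithLp.ofLp (Uiso v)).2 := by
  have hTΘ : ∀ w ∈ (span ℂ (Set.range x)).topologicalClosure, T w ∈ (span ℂ (Set.range x)).topologicalClosure := fun w hw =>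
    map_mem_topologicalClosure_span_of_apply_mem x T (fun i => (hTx i) ▸ mem_topologicalClosure_span x (σ i)) hw
  refine (denseRange_codRestrict_linearCombination x).induction_on
    (p := fun w => (WithLp.ofLp (Uiso ⟨T w, hTΘ w w.2⟩)).2 = S₂ (WithLp.ofLp (Uiso w)).2) v (isClosed_eq ?_ ?_) fun l => ?_
  · exact continuous_snd.comp ((WithLp.prod_continuous_ofLp 2 H M₂).comp (Uiso.continuous.comp ((T.continuous.comp continuous_subtype_val).subtype_mk _)))
  · exact S₂.continuous.comp (continuous_snd.comp ((WithLp.prod_continuous_ofLp 2 H M₂).comp Uiso.continuous))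
  · -- on a finite combination
    have hT : T (Finsupp.linearCombination ℂ x l) = Finsupp.linearCombination ℂ x (Finsupp.mapDomain σ l) := by
      rw [Finsupp.linearCombination_mapDomain]
      have h := Finsupp.apply_linearCombination ℂ T.toLinearMap x l
      rw [ContinuousLinearMap.coe_coe] at h
      rw [h]
      exact congrArg (fun y : ι → H => Finsupp.linearCombination ℂ y l) (funext fun i => hTx i)
    have hmk : (⟨T ((LinearMap.codRestrict (span ℂ (Set.range x)).topologicalClosure (Finsupp.linearCombination ℂ x) (linearCombination_mem_topologicalClosure x) l :
        (span ℂ (Set.range x)).topologicalClosure) : H), hTΘ _ (Subtype.mem _)⟩ : (span ℂ (Set.range x)).topologicalClosure) =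
        ⟨Finsupp.linearCombination ℂ x (Finsupp.mapDomain σ l), linearCombination_mem_topologicalClosure x _⟩ := Subtype.ext hT
    have hsnd : ∀ l' : ι →₀ ℂ, (WithLp.ofLp (Finsupp.linearCombination ℂ (fun i => WithLp.toLp 2 (R.starProjection (x i), c i)) l')).2 = Finsupp.linearCombination ℂ c l' :=
      fun l' => by
        have h := Finsupp.apply_linearCombination ℂ ((LinearMap.snd ℂ H M₂).comp (WithLp.linearEquiv 2 ℂ (H × M₂)).toLinearMap)
          (fun i => WithLp.toLp 2 (R.starProjection (x i), c i)) l'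
        rw [LinearMap.comp_apply, LinearMap.snd_apply] at h
        exact h
    change (WithLp.ofLp (Uiso ⟨T ((LinearMap.codRestrict (span ℂ (Set.range x)).topologicalClosure (Finsupp.linearCombination ℂ x)
        (linearCombination_mem_topologicalClosure x) l : (span ℂ (Set.range x)).topologicalClosure) : H), hTΘ _ (Subtype.mem _)⟩)).2 =
      S₂ (WithLp.ofLp (Uiso ⟨Finsupp.linearCombination ℂ x l, linearCombination_mem_topologicalClosure x l⟩)).2
    rw [hmk, linearIsometry_apply_linearCombination Uiso hUiso, linearIsometry_apply_linearCombination Uiso hUiso l, hsnd, hsnd, Finsupp.linearCombination_mapDomain]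
    have hS := Finsupp.apply_linearCombination ℂ S₂.toLinearMap c l
    rw [ContinuousLinearMap.coe_coe] at hS
    rw [hS]
    exact congrArg (fun y : ι → M₂ => Finsupp.linearCombination ℂ y l) (funext fun i => hSymb i)

end Isometry

/-- **`P_Θ` COMMUTES WITH `T`** when `T Θ ⊆ Θ` and `T† Θ ⊆ Θ`: `P_Θ (T v) = T (P_Θ v)` for every `v ∈ H` (`T v = T (P_Θ v) + T (v − P_Θ v)`, the second summand in `Θᗮ` by ★ `map_mem_orthogonal_of_adjoint`).
E1: Hecke operators and their adjoints preserve the τ-cut block. [cite: ReedSimonI1980, Thm. II.3] -/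
theorem coe_orthogonalProjectionOnto_map_eq [CompleteSpace H] (x : ι → H) (T : H →L[ℂ] H)
    (hTΘ : ∀ w ∈ (span ℂ (Set.range x)).topologicalClosure, T w ∈ (span ℂ (Set.range x)).topologicalClosure)
    (hTadjΘ : ∀ w ∈ (span ℂ (Set.range x)).topologicalClosure, ContinuousLinearMap.adjoint T w ∈ (span ℂ (Set.range x)).topologicalClosure) (v : H) :
    haveI := completeSpace_topologicalClosure_span x
    ((span ℂ (Set.range x)).topologicalClosure.orthogonalProjectionOnto (T v) : H) =
      T ((span ℂ (Set.range x)).topologicalClosure.orthogonalProjectionOnto v : H) := by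
  haveI := completeSpace_topologicalClosure_span x
  rw [coe_orthogonalProjectionOnto_apply]
  refine eq_starProjection_of_mem_orthogonal (hTΘ _ (Subtype.mem _)) ?_
  rw [← map_sub]
  refine map_mem_orthogonal_of_adjoint _ T hTadjΘ ?_
  rw [coe_orthogonalProjectionOnto_apply]
  exact sub_starProjection_mem_orthogonal v

/-! ## §4 The package: the global line model of a Gram identity with projected residual part -/

/-- **THE LINE MODEL OF A GRAM IDENTITY WITH PROJECTED RESIDUAL PART (bricks PB-3 + PB-4, generic symbols).**  `H` complete, `R ≤ H` with orthogonal projection `P_R` (E1: span of the residues),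
`x : ι → H` (pseudo-Eisenstein vectors), `Θ = closure span {x i}`, `c : ι → M₂` (continuous coordinates), **`hG : ⟪x i, x j⟫ = ⟪P_R x i, P_R x j⟫ + ⟪c i, c j⟫`** (PB-2); a family of bounded
`T j` with `T j (x i) = x (σ j i)`, `(T j)† (x i) ∈ Θ` (PB-3a) and bounded symbols `S₂ j` with `c (σ j i) = S₂ j (c i)`.  THEN there is a linear `U : H →ₗ[ℂ] M₂` (the global model map
`snd ∘ Uiso ∘ P_Θ`) with: `U (x i) = c i`; **`U (T j v) = S₂ j (U v)` for all `v`** (the `hU` letter); `U = 0` on `Θᗮ`; `‖U v‖ = ‖v − P_R v‖` on `Θ`; **`U y = 0 → P_Θ y ∈ R`**; and the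
(C)-shape **`v ∈ Θ`, `v ⟂ R`, `U y = 0` ⟹ `⟪v, y⟫ = 0`**. [cite: MoeglinWaldspurger1995, II.2.4, IV.3.1, VI.2] [cite: Langlands1976, §7] [cite: ReedSimonI1980, Thm. I.7, Thm. II.3] -/
theorem exists_lineModel_of_gram_proj [CompleteSpace H] [CompleteSpace M₂] (R : Submodule ℂ H) [R.HasOrthogonalProjection] (x : ι → H) (c : ι → M₂)
    (hG : ∀ i j, ⟪x i, x j⟫_ℂ = ⟪R.starProjection (x i), R.starProjection (x j)⟫_ℂ + ⟪c i, c j⟫_ℂ)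
    {J : Type*} (T : J → H →L[ℂ] H) (σ : J → ι → ι) (hTx : ∀ j i, T j (x i) = x (σ j i))
    (hTadjx : ∀ j i, ContinuousLinearMap.adjoint (T j) (x i) ∈ (span ℂ (Set.range x)).topologicalClosure)
    (S₂ : J → M₂ →L[ℂ] M₂) (hSymb : ∀ j i, c (σ j i) = S₂ j (c i)) :
    ∃ U : H →ₗ[ℂ] M₂, (∀ i, U (x i) = c i) ∧ (∀ j v, U (T j v) = S₂ j (U v)) ∧ (∀ v ∈ ((span ℂ (Set.range x)).topologicalClosure)ᗮ, U v = 0) ∧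
      (∀ v ∈ (span ℂ (Set.range x)).topologicalClosure, ‖U v‖ = ‖v - R.starProjection v‖) ∧
      (∀ y, U y = 0 → (haveI := completeSpace_topologicalClosure_span x; (span ℂ (Set.range x)).topologicalClosure.starProjection y) ∈ R) ∧
      (∀ v ∈ (span ℂ (Set.range x)).topologicalClosure, (∀ w ∈ R, ⟪w, v⟫_ℂ = 0) → ∀ y, U y = 0 → ⟪v, y⟫_ℂ = 0) := by
  haveI := completeSpace_topologicalClosure_span x
  obtain ⟨Uiso, hUiso⟩ := exists_linearIsometry_of_inner_eq_add (fun i => R.starProjection (x i)) c hG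
  have hTΘ : ∀ j, ∀ w ∈ (span ℂ (Set.range x)).topologicalClosure, T j w ∈ (span ℂ (Set.range x)).topologicalClosure := fun j w hw =>
    map_mem_topologicalClosure_span_of_apply_mem x (T j) (fun i => (hTx j i) ▸ mem_topologicalClosure_span x (σ j i)) hw
  have hTadjΘ : ∀ j, ∀ w ∈ (span ℂ (Set.range x)).topologicalClosure, ContinuousLinearMap.adjoint (T j) w ∈ (span ℂ (Set.range x)).topologicalClosure := fun j w hw =>
    map_mem_topologicalClosure_span_of_apply_mem x (ContinuousLinearMap.adjoint (T j)) (hTadjx j) hw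
  set P := (span ℂ (Set.range x)).topologicalClosure.orthogonalProjectionOnto with hP
  -- the kernel clause at the level of `Uiso ∘ P_Θ`
  have hker : ∀ y : H, (WithLp.ofLp (Uiso (P y))).2 = 0 → (P y : H) ∈ R := fun y hy => (snd_isometry_eq_zero_iff R Uiso hUiso (P y)).1 hy
  refine ⟨(LinearMap.snd ℂ H M₂) ∘ₗ (WithLp.linearEquiv 2 ℂ (H × M₂)).toLinearMap ∘ₗ (Uiso.toContinuousLinearMap.comp P).toLinearMap, fun i => ?_, fun j v => ?_, fun v hv => ?_,
    fun v hv => ?_, fun y hy => ?_, fun v hv hvR y hy => ?_⟩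
  · -- `U (x i) = c i`
    change (WithLp.ofLp (Uiso (P (x i)))).2 = c i
    have hPx : P (x i) = ⟨x i, mem_topologicalClosure_span x i⟩ := orthogonalProjectionOnto_mem_subspace_eq_self (⟨x i, mem_topologicalClosure_span x i⟩ : (span ℂ (Set.range x)).topologicalClosure)
    rw [hPx, hUiso]
  · -- the `hU` letter: `U (T j v) = S₂ j (U v)`
    change (WithLp.ofLp (Uiso (P (T j v)))).2 = S₂ j (WithLp.ofLp (Uiso (P v))).2
    have hPT : P (T j v) = ⟨T j (P v : H), hTΘ j _ (Subtype.mem _)⟩ := Subtype.ext (coe_orthogonalProjectionOnto_map_eq x (T j) (hTΘ j) (hTadjΘ j) v)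
    rw [hPT]
    exact snd_isometry_map_eq_of_equivariant R Uiso hUiso (T j) (σ j) (hTx j) (S₂ j) (hSymb j) (P v)
  · -- `U = 0` on `Θᗮ`
    change (WithLp.ofLp (Uiso (P v))).2 = 0
    rw [hP, orthogonalProjectionOnto_eq_zero_iff.2 hv, map_zero]
    rfl
  · -- `‖U v‖ = ‖v - P_R v‖` on `Θ`
    change ‖(WithLp.ofLp (Uiso (P v))).2‖ = ‖v - R.starProjection v‖
    have hPv : P v = ⟨v, hv⟩ := orthogonalProjectionOnto_mem_subspace_eq_self (⟨v, hv⟩ : (span ℂ (Set.range x)).topologicalClosure)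
    rw [hPv]
    exact norm_snd_isometry_eq R Uiso hUiso ⟨v, hv⟩
  · -- `U y = 0 → P_Θ y ∈ R`
    exact hker y hy
  · -- `v ∈ Θ`, `v ⟂ R`, `U y = 0` ⟹ `⟪v, y⟫ = 0`
    have h1 : ⟪v, y⟫_ℂ = ⟪v, (span ℂ (Set.range x)).topologicalClosure.starProjection y⟫_ℂ := by
      rw [← inner_starProjection_left_eq_right, starProjection_eq_self_iff.2 hv]
    rw [h1]
    exact inner_eq_zero_symm.1 (hvR _ (hker y hy))

/-! ## §5 The Hölder edition: the (L2) + (C) letters of the τ-cut bill -/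

/-- **THE (L2) + (C) LETTERS OF THE τ-CUT BILL FROM THE GRAM IDENTITY (bricks PB-3 + PB-4, Hölder symbols).**  As §4 with `M₂ = Lp E 2 m` (E1: `L²` of the unitary axis with values in the
`τ`-coordinates) and the symbols acting by the Hölder `L∞`-action, `c (σ j i) = (hs j).toLp (s j) • c i` (PB-3a: `s j` the Satake scalar of `T j` along the axis); `Sc′ = Θ` (PB-0′, the τ-cut
density) and `R ≤ A` (the residues lie in the visible residue space `A = span eTop ⊔ span eMid`).  OUTPUT: `∃ U : H →ₗ[ℂ] Lp E 2 m` with `U (x i) = c i`, the letter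
**`hU : ∀ j v, U (T j v) = (hs j).toLp (s j) • U v`** of ★ `resG_isotypic_le_orthogonal_of_lineModel_of_conv` (there guarded by `v ∈ Fix P`; here for all `v`), `U = 0` on `Sc′ᗮ`,
`‖U v‖ = ‖v − P_R v‖` on `Sc′`, and the letter **`hLnU : ∀ v ∈ Sc′ ⊓ Aᗮ, ∀ y, U y = 0 → ⟪v, y⟫ = 0`** at `Ln := Sc′ ⊓ Aᗮ` (there guarded by `y ∈ Fix P`).  The (L3) letter `hline` is ★
`hline_of_satakeSymbol`. [cite: MoeglinWaldspurger1995, II.2.4, IV.3.1, VI.2] [cite: Langlands1976, §7] -/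
theorem exists_lineModelLetters_of_gram_proj [CompleteSpace H] {Ω : Type*} {mΩ : MeasurableSpace Ω} {m : Measure Ω}
    {E : Type*} [NormedAddCommGroup E] [InnerProductSpace ℂ E] [CompleteSpace E] [ENNReal.HolderTriple ∞ 2 2]
    (R : Submodule ℂ H) [R.HasOrthogonalProjection] (x : ι → H) (c : ι → Lp E 2 m)
    (hG : ∀ i j, ⟪x i, x j⟫_ℂ = ⟪R.starProjection (x i), R.starProjection (x j)⟫_ℂ + ⟪c i, c j⟫_ℂ)
    {J : Type*} (T : J → H →L[ℂ] H) (σ : J → ι → ι) (hTx : ∀ j i, T j (x i) = x (σ j i))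
    (hTadjx : ∀ j i, ContinuousLinearMap.adjoint (T j) (x i) ∈ (span ℂ (Set.range x)).topologicalClosure)
    (s : J → Ω → ℂ) (hs : ∀ j, MemLp (s j) ∞ m) (hSymb : ∀ j i, c (σ j i) = (hs j).toLp (s j) • c i)
    (Sc' A : Submodule ℂ H) (hΘ : (span ℂ (Set.range x)).topologicalClosure = Sc') (hRA : R ≤ A) :
    ∃ U : H →ₗ[ℂ] Lp E 2 m, (∀ i, U (x i) = c i) ∧ (∀ j v, U (T j v) = (hs j).toLp (s j) • U v) ∧ (∀ v ∈ Sc'ᗮ, U v = 0) ∧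
      (∀ v ∈ Sc', ‖U v‖ = ‖v - R.starProjection v‖) ∧ (∀ v ∈ Sc' ⊓ Aᗮ, ∀ y, U y = 0 → ⟪v, y⟫_ℂ = 0) := by
  subst hΘ
  -- the Hölder multiplication by the symbol class as a bounded operator on `Lp E 2 m`
  have hMφ : ∀ j, ∃ Mφ : Lp E 2 m →L[ℂ] Lp E 2 m, ∀ f, Mφ f = (hs j).toLp (s j) • f := fun j =>
    ⟨LinearMap.mkContinuous
        { toFun := fun f => (hs j).toLp (s j) • f
          map_add' := fun f g => Lp.add_smul _ f g
          map_smul' := fun a f => (Lp.smul_comm a ((hs j).toLp (s j)) f).symm }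
        ‖(hs j).toLp (s j)‖ (fun f => Lp.norm_smul_le _ f), fun f => rfl⟩
  choose Mφ hMφ' using hMφ
  obtain ⟨U, h1, h2, h3, h4, -, h6⟩ := exists_lineModel_of_gram_proj R x c hG T σ hTx hTadjx Mφ (fun j i => by rw [hMφ']; exact hSymb j i)
  refine ⟨U, h1, fun j v => by rw [h2, hMφ'], h3, h4, fun v hv y hy => ?_⟩
  exact h6 v (Submodule.mem_inf.1 hv).1 (fun w hw => inner_right_of_mem_orthogonal (hRA hw) (Submodule.mem_inf.1 hv).2) y hy

/-! ## §6 Bridge from the abstract residue-Gram currency (PB-2c: `⟪r i, r j⟫_{M₁}`, residues `e`, models `b`) to the projected form -/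

/-- **THE PROJECTED RESIDUAL GRAM FROM RESIDUE GRAM LETTERS.**  `x : ι → H` with abstract residual models `r : ι → M₁` (PB-2c: `r i = (B_c(f̂_i(−c)·φ_i))_c`, `R_c = B_c†B_c`), and RESIDUE
VECTORS `e : k → H` (E1: the `L²` residues `Res_{z=c} E(z, φ)`, [MoeglinWaldspurger1995] IV.3.1) with models `b : k → M₁` such that `⟪e p, e q⟫ = ⟪b p, b q⟫`, `⟪x i, e p⟫ = ⟪r i, b p⟫` and
`r i ∈ closure span {b p}`.  THEN with `R := closure span {e p}`: `⟪P_R x i, P_R x j⟫ = ⟪r i, r j⟫` — so the abstract Gram identity `⟪x i, x j⟫ = ⟪r i, r j⟫ + ⟪c i, c j⟫` IS the projected one of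
§4–§5.  (The isometry `V : R →ₗᵢ M₁`, `V e p = b p` (★ `exists_linearIsometry_of_inner_eq`) hits `r i = V w_i`; `x i − w_i ⟂ e p` for all `p`, hence `P_R x i = w_i`.)
[cite: MoeglinWaldspurger1995, II.2.4, IV.3.1, VI.2] [cite: ReedSimonI1980, Thm. I.7, Thm. II.3] -/
theorem inner_starProjection_eq_of_residueGram [CompleteSpace H] {M₁ : Type*} [NormedAddCommGroup M₁] [InnerProductSpace ℂ M₁] [CompleteSpace M₁]
    (x : ι → H) (r : ι → M₁) {k : Type*} (e : k → H) (b : k → M₁)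
    (hee : ∀ p q, ⟪e p, e q⟫_ℂ = ⟪b p, b q⟫_ℂ) (hxe : ∀ i p, ⟪x i, e p⟫_ℂ = ⟪r i, b p⟫_ℂ) (hr : ∀ i, r i ∈ (span ℂ (Set.range b)).topologicalClosure) (i j : ι) :
    haveI := completeSpace_topologicalClosure_span e
    ⟪(span ℂ (Set.range e)).topologicalClosure.starProjection (x i), (span ℂ (Set.range e)).topologicalClosure.starProjection (x j)⟫_ℂ = ⟪r i, r j⟫_ℂ := by
  haveI := completeSpace_topologicalClosure_span e
  obtain ⟨V, -, hV⟩ := exists_linearIsometry_of_inner_eq hee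
  have hrange : ∀ i, ∃ w : (span ℂ (Set.range e)).topologicalClosure, V w = r i := fun i => by
    have h : r i ∈ Set.range V := by
      rw [range_linearIsometry_eq_topologicalClosure_span V hV]
      exact hr i
    exact h
  choose w hw using hrange
  -- `P_R (x i) = w i`: `x i - w i` is orthogonal to every generator `e p`, hence to `R`
  have hP : ∀ i, (span ℂ (Set.range e)).topologicalClosure.starProjection (x i) = w i := fun i => by
    refine eq_starProjection_of_mem_of_inner_eq_zero (w i).2 fun z hz => ?_
    have hgen : span ℂ (Set.range e) ≤ (ℂ ∙ (x i - (w i : H)))ᗮ :=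
      span_le.2 (Set.range_subset_iff.2 fun p => by
        rw [SetLike.mem_coe, mem_orthogonal_singleton_iff_inner_right, inner_sub_left, hxe i p]
        have h2 : ⟪((w i : (span ℂ (Set.range e)).topologicalClosure) : H), e p⟫_ℂ = ⟪V (w i), V ⟨e p, mem_topologicalClosure_span e p⟩⟫_ℂ := by
          rw [LinearIsometry.inner_map_map]; rfl
        rw [h2, hw i, hV p, sub_self])
    exact mem_orthogonal_singleton_iff_inner_right.1 ((span ℂ (Set.range e)).topologicalClosure_minimal hgen (isClosed_orthogonal _) hz)
  rw [hP i, hP j]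
  have h3 : ⟪((w i : (span ℂ (Set.range e)).topologicalClosure) : H), ((w j : (span ℂ (Set.range e)).topologicalClosure) : H)⟫_ℂ = ⟪V (w i), V (w j)⟫_ℂ := by
    rw [LinearIsometry.inner_map_map]; rfl
  rw [h3, hw i, hw j]

/-- **THE (L2) + (C) LETTERS FROM THE ABSTRACT GRAM IDENTITY AND THE RESIDUE GRAM LETTERS (PB-2 abstract currency ⇒ PB-3 + PB-4).**  Input: `hG : ⟪x i, x j⟫ = ⟪r i, r j⟫_{M₁} + ⟪c i, c j⟫`
(the bytes of ★ `exists_linearIsometry_of_inner_eq_add`, PB-2b∕2c), the residues `e : k → H` with models `b` (`hee`, `hxe`, `hr` as in `inner_starProjection_eq_of_residueGram`) lying in the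
visible residue space (`hRA : closure span {e p} ≤ A` — for finitely many residues `closure span = span`), PB-3a (`hTx`, `hTadjx`, `hSymb`) and PB-0′ (`closure span {x i} = Sc′`).  OUTPUT: the
letters `hU` and `hLnU` (at `Ln := Sc′ ⊓ Aᗮ`) of ★ `resG_isotypic_le_orthogonal_of_lineModel_of_conv`, unguarded, with `U (x i) = c i` and `U = 0` on `Sc′ᗮ`.
[cite: MoeglinWaldspurger1995, II.2.4, IV.3.1, VI.2] [cite: Langlands1976, §7] -/
theorem exists_lineModelLetters_of_gram_residueGram [CompleteSpace H] {Ω : Type*} {mΩ : MeasurableSpace Ω} {m : Measure Ω}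
    {E : Type*} [NormedAddCommGroup E] [InnerProductSpace ℂ E] [CompleteSpace E] [ENNReal.HolderTriple ∞ 2 2]
    {M₁ : Type*} [NormedAddCommGroup M₁] [InnerProductSpace ℂ M₁] [CompleteSpace M₁]
    (x : ι → H) (r : ι → M₁) (c : ι → Lp E 2 m) (hG : ∀ i j, ⟪x i, x j⟫_ℂ = ⟪r i, r j⟫_ℂ + ⟪c i, c j⟫_ℂ)
    {k : Type*} (e : k → H) (b : k → M₁)
    (hee : ∀ p q, ⟪e p, e q⟫_ℂ = ⟪b p, b q⟫_ℂ) (hxe : ∀ i p, ⟪x i, e p⟫_ℂ = ⟪r i, b p⟫_ℂ) (hr : ∀ i, r i ∈ (span ℂ (Set.range b)).topologicalClosure)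
    {J : Type*} (T : J → H →L[ℂ] H) (σ : J → ι → ι) (hTx : ∀ j i, T j (x i) = x (σ j i))
    (hTadjx : ∀ j i, ContinuousLinearMap.adjoint (T j) (x i) ∈ (span ℂ (Set.range x)).topologicalClosure)
    (s : J → Ω → ℂ) (hs : ∀ j, MemLp (s j) ∞ m) (hSymb : ∀ j i, c (σ j i) = (hs j).toLp (s j) • c i)
    (Sc' A : Submodule ℂ H) (hΘ : (span ℂ (Set.range x)).topologicalClosure = Sc') (hRA : (span ℂ (Set.range e)).topologicalClosure ≤ A) :
    ∃ U : H →ₗ[ℂ] Lp E 2 m, (∀ i, U (x i) = c i) ∧ (∀ j v, U (T j v) = (hs j).toLp (s j) • U v) ∧ (∀ v ∈ Sc'ᗮ, U v = 0) ∧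
      (∀ v ∈ Sc' ⊓ Aᗮ, ∀ y, U y = 0 → ⟪v, y⟫_ℂ = 0) := by
  haveI := completeSpace_topologicalClosure_span e
  have hG' : ∀ i j, ⟪x i, x j⟫_ℂ = ⟪(span ℂ (Set.range e)).topologicalClosure.starProjection (x i), (span ℂ (Set.range e)).topologicalClosure.starProjection (x j)⟫_ℂ + ⟪c i, c j⟫_ℂ :=
    fun i j => by rw [inner_starProjection_eq_of_residueGram x r e b hee hxe hr i j]; exact hG i j
  obtain ⟨U, h1, h2, h3, -, h5⟩ := exists_lineModelLetters_of_gram_proj (span ℂ (Set.range e)).topologicalClosure x c hG' T σ hTx hTadjx s hs hSymb Sc' A hΘ hRA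
  exact ⟨U, h1, h2, h3, h5⟩

end Summit.HodgeConjecture.HodgeConjecture.R90.S8

end
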